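import Literature.NumberTheory.Transcendental.DiazGrid
import Literature.NumberTheory.Transcendental.ExpSmallTrdegProofsIV
import Literature.Barriers.Schanuel.LargeTranscendenceDegreeProofs
import HarnessLib

/-!
# Diaz's `d × ℓ` grid, clause `t₂ ≥ dℓ/(ℓ+d)` (`Diaz1989_gridXY`): the range of bound `2`, proved,
# and what is left

Topic `Literature/NumberTheory/Transcendental`. Proof companion of `DiazGrid.lean` for the named
fact `Literature.NumberTheory.Transcendental.Diaz1989_gridXY` (Nesterenko–Philippon (eds.),
LNM 1752, Ch. 14 (M. Waldschmidt), Theorem 2.7, third conclusion, quoted there from Diaz 1989 and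
attributed in §2.3, p. 217, to Philippon 1986, Théorème 2.12 (i)): for `ℚ`-linearly independent
`x₁, …, x_d` and `y₁, …, y_ℓ` satisfying the Technical Hypothesis, `dℓ > ℓ + d`, and any subfield
`K ⊆ ℂ` containing the `e^{xᵢyⱼ}`, `t₂ = trdeg_ℚ K(x₁, …, x_d, y₁, …, y_ℓ) ≥ dℓ/(ℓ+d)`, encoded
`⌈dℓ/(ℓ+d)⌉ ≤ t₂`.

A sibling file is needed because `DiazGrid.lean` sits below `DiazMain.lean`,
`PhilipponExpGrid.lean` and the small-transcendence-degree files in the import order.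

Everything here is PROVED; no definition and no named fact is introduced.

* `DiazGrid.two_le_natCeil`, `DiazGrid.natCeil_le_two_iff`, `DiazGrid.natCeil_eq_two`,
  `DiazGrid.smallRange_iff` — arithmetic of the printed bound: under the standing hypothesis
  `dℓ > ℓ + d` one always has `⌈dℓ/(ℓ+d)⌉ ≥ 2`, with equality exactly in the range
  `dℓ ≤ 2(ℓ+d)`, i.e. for `d = 2` (`ℓ ≥ 3`), `ℓ = 2` (`d ≥ 3`) and
  `(d, ℓ) ∈ {(3,3), (3,4), (3,5), (3,6), (4,3), (4,4), (5,3), (6,3)}`.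
* `Diaz1989_gridXY.two_le_trdeg` — **`t₂ ≥ 2` whenever `dℓ > ℓ + d`, for `ℚ`-linearly independent
  `x`, `y` and ANY `K ∋ e^{xᵢyⱼ}`, with no Technical Hypothesis**: this is LNM 1752, Ch. 13,
  Theorem 3.1 (iv) (Brownawell 1974 / Waldschmidt 1973; = Ch. 14, Theorem 2.9, clause `t₂`), which
  the tree PROVES (`Laurent2001_thm_3_1_iv_holds`, `ExpSmallTrdegProofsIV.lean`, Gel'fond's method
  with Tijdeman's zero estimate and Gel'fond's criterion), transported from the generated field
  `gridField₂ x y = ℚ(x, y, e^{xᵢyⱼ})` to `K(x, y) ⊇ gridField₂ x y` by monotonicity of `trdeg`.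
* `Diaz1989_gridXY_smallRange` — hence **the conclusion of `Diaz1989_gridXY` HOLDS outright in the
  range `dℓ ≤ 2(ℓ+d)`** (there `⌈dℓ/(ℓ+d)⌉ = 2`), again without (T.H.).
* `Diaz1989_gridXY_of_gridField₂`, `Diaz1989_gridXY_of_largeRange`,
  `Diaz1989_gridXY_of_philippon_i_largeRange` — reductions of the fact: it suffices to bound the
  transcendence degree of the generated field `gridField₂ x y` (the printed "any `K` containing
  the `e^{xᵢyⱼ}`" follows by `trdeg_mono`), it suffices to do so in the complementary range
  `2(ℓ+d) < dℓ`, and in that range it suffices to have conclusion (i) of Philippon's Théorème 2.12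
  (`Philippon1986_thm_2_12`, `PhilipponExpGrid.lean`, whose full statement already gives the fact:
  `Diaz1989_gridXY_of_philippon`).

What is NOT here: the discharge `Diaz1989_gridXY_holds`. In the range `2(ℓ+d) < dℓ` the bound
`⌈dℓ/(ℓ+d)⌉ ≥ 3` is a statement of LARGE transcendence degree; its only printed proofs
(Philippon 1986, Théorème 2.12 (i): "On reprend [P1] jusque et y compris le §4 … le corollaire
(0.2) avec `η = n+1`. Le reste de la démonstration est un exercice", p. 40; Diaz 1989) go through
Philippon's criterion for algebraic independence (`Philippon1986_mainCriterion`, IHÉS 64,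
Théorème 2.11, named fact of `PhilipponCriterion.lean`) together with Gel'fond's method with
derivatives on `𝔾ₐ × 𝔾ₘ^d` and a zero estimate with multiplicities; none of Diaz's Théorèmes 1, 2
(clauses `t`, `t₁`) implies clause `t₂` (for `dℓ = q(ℓ+d) + r` with `0 < r < min(d, ℓ)`, e.g.
`(d, ℓ) = (4, 5)`, one has `[(dℓ+max(d,ℓ))/(ℓ+d)] = q < q + 1 = ⌈dℓ/(ℓ+d)⌉`). The fact is thus
downstream of `Philippon1986_thm_2_12` (equivalently of Laurent's transcription
`Diaz1989_main_iii`, `Diaz1989_gridXY_of_main`).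

## References

* Yu. V. Nesterenko, P. Philippon (eds.), *Introduction to Algebraic Independence Theory*,
  LNM 1752, Springer 2001: Ch. 13 (M. Laurent), Theorem 3.1 (iv), PDF p. 233; Ch. 14
  (M. Waldschmidt), Theorem 2.7 and Remark (PDF p. 248), Theorem 2.9 (PDF p. 249), §2.3
  (PDF p. 250). [NesterenkoPhilippon2001]
* P. Philippon, *Critères pour l'indépendance algébrique*, Publ. Math. IHÉS 64 (1986), 5–52,
  Théorème 2.12, pp. 39–40. [Philippon1986Criteres]
* G. Diaz, *Grands degrés de transcendance pour des familles d'exponentielles*, J. Number Theory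
  31 (1989), 1–23 (main theorem, as quoted in LNM 1752, Ch. 14, Theorem 2.7). [Diaz1989]
* A. Baker, *Transcendental Number Theory*, Cambridge Univ. Press (1975), Ch. 12, Theorem 12.2,
  p. 111. [BakerTNT1975]
-/

noncomputable section

open IntermediateField Complex

namespace Literature.NumberTheory.Transcendental

open Literature.Barriers.Schanuel (gridField₂ trdeg_mono gridField₂_le_of_mem)

/-! ### Arithmetic of the bound `⌈dℓ/(ℓ+d)⌉` -/

/-- Under the standing hypothesis `ℓ + d < dℓ` of Theorem 2.7 the printed bound for `t₂` is at
least `2`: `⌈dℓ/(ℓ+d)⌉ ≥ 2` (`dℓ/(ℓ+d) > 1`). [folklore] -/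
theorem DiazGrid.two_le_natCeil {d l : ℕ} (h : l + d < d * l) :
    2 ≤ ⌈(d * l : ℚ) / (l + d)⌉₊ := by
  have hd : d ≠ 0 := by
    rintro rfl
    omega
  have hpos : (0 : ℚ) < l + d := by exact_mod_cast (show 0 < l + d by omega)
  have h' : ((l : ℚ) + d) < d * l := by exact_mod_cast h
  have h1 : (1 : ℚ) < d * l / (l + d) := (one_lt_div hpos).mpr h'
  have key : 1 < ⌈(d * l : ℚ) / (l + d)⌉₊ := Nat.lt_ceil.mpr (by exact_mod_cast h1)
  omega

/-- For `ℓ + d > 0`: `⌈dℓ/(ℓ+d)⌉ ≤ 2 ↔ dℓ ≤ 2(ℓ+d)`. [folklore] -/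
theorem DiazGrid.natCeil_le_two_iff {d l : ℕ} (hpos : 0 < l + d) :
    ⌈(d * l : ℚ) / (l + d)⌉₊ ≤ 2 ↔ d * l ≤ 2 * (l + d) := by
  have hpos' : (0 : ℚ) < l + d := by exact_mod_cast hpos
  rw [Nat.ceil_le, div_le_iff₀ hpos']
  constructor
  · intro h
    exact_mod_cast h
  · intro h
    exact_mod_cast h

/-- In the range `ℓ + d < dℓ ≤ 2(ℓ+d)` the printed bound for `t₂` is exactly `2`:
`⌈dℓ/(ℓ+d)⌉ = 2`. [folklore] -/
theorem DiazGrid.natCeil_eq_two {d l : ℕ} (h : l + d < d * l) (h2 : d * l ≤ 2 * (l + d)) :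
    ⌈(d * l : ℚ) / (l + d)⌉₊ = 2 := by
  have hd : d ≠ 0 := by
    rintro rfl
    omega
  exact le_antisymm ((DiazGrid.natCeil_le_two_iff (by omega)).mpr h2) (DiazGrid.two_le_natCeil h)

/-- Conversely, in the range `2(ℓ+d) < dℓ` the printed bound is at least `3`. [folklore] -/
theorem DiazGrid.three_le_natCeil {d l : ℕ} (h : 2 * (l + d) < d * l) :
    3 ≤ ⌈(d * l : ℚ) / (l + d)⌉₊ := by
  have hd : d ≠ 0 := by
    rintro rfl
    omega
  have hpos : 0 < l + d := by omega
  have key : ¬ ⌈(d * l : ℚ) / (l + d)⌉₊ ≤ 2 := fun hle =>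
    absurd ((DiazGrid.natCeil_le_two_iff hpos).mp hle) (not_le.mpr h)
  omega

/-- **The range of bound `2`, listed**: for `ℓ + d < dℓ`, one has `dℓ ≤ 2(ℓ+d)` (equivalently
`(d-2)(ℓ-2) ≤ 4`) iff `d = 2`, or `ℓ = 2`, or
`(d, ℓ) ∈ {(3,3), (3,4), (3,5), (3,6), (4,3), (4,4), (5,3), (6,3)}`. [folklore] -/
theorem DiazGrid.smallRange_iff {d l : ℕ} (h : l + d < d * l) :
    d * l ≤ 2 * (l + d) ↔
      d = 2 ∨ l = 2 ∨ (d, l) ∈ ({(3, 3), (3, 4), (3, 5), (3, 6), (4, 3), (4, 4), (5, 3), (6, 3)} :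
        Finset (ℕ × ℕ)) := by
  have hd : d ≠ 0 := by
    rintro rfl
    omega
  have hl : l ≠ 0 := by
    rintro rfl
    omega
  constructor
  · intro h2
    rcases Nat.lt_or_ge d 7 with hd7 | hd7
    · rcases Nat.lt_or_ge l 7 with hl7 | hl7
      · interval_cases d <;> interval_cases l <;> simp_all
      · interval_cases d <;> omega
    · rcases Nat.lt_or_ge l 3 with hl3 | hl3
      · interval_cases l <;> omega
      · exfalso
        nlinarith
  · rintro (rfl | rfl | hmem)
    · omega
    · omega
    · simp only [Finset.mem_insert, Finset.mem_singleton, Prod.mk.injEq] at hmem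
      rcases hmem with ⟨rfl, rfl⟩ | ⟨rfl, rfl⟩ | ⟨rfl, rfl⟩ | ⟨rfl, rfl⟩ | ⟨rfl, rfl⟩ | ⟨rfl, rfl⟩ |
        ⟨rfl, rfl⟩ | ⟨rfl, rfl⟩ <;> norm_num

/-! ### `t₂ ≥ 2` for `dℓ > ℓ + d`, with no Technical Hypothesis -/

/-- **`trdeg_ℚ K(x₁, …, x_d, y₁, …, y_ℓ) ≥ 2` whenever `dℓ > ℓ + d`**, for `ℚ`-linearly
independent `x`, `y` and any intermediate field `K ∋ e^{xᵢyⱼ}`, WITHOUT the Technical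
Hypothesis: LNM 1752, Ch. 13, Theorem 3.1 (iv) (`mn ≥ m + n + 1 ⇒ trdeg ℚ(xᵢ, yⱼ, e^{xᵢyⱼ}) ≥ 2`,
proved in the tree as `Laurent2001_thm_3_1_iv_holds`) for the generated field
`gridField₂ x y = ℚ(x, y, e^{xᵢyⱼ}) ≤ K(x, y)`, and monotonicity of the transcendence degree.
(`dℓ > ℓ + d` forces `d, ℓ ≥ 1`.) This is clause `t₂` of Ch. 14, Theorem 2.9, in the shape of
Theorem 2.7. [cite: NesterenkoPhilippon2001, Ch. 13 Theorem 3.1 (iv), PDF p. 233; Ch. 14 Theorem 2.9]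
[cite: BakerTNT1975, Ch. 12 Theorem 12.2, p. 111] -/
theorem Diaz1989_gridXY.two_le_trdeg {d l : ℕ} (x : Fin d → ℂ) (y : Fin l → ℂ)
    (hx : LinearIndependent ℚ x) (hy : LinearIndependent ℚ y) (h : l + d < d * l)
    (K : IntermediateField ℚ ℂ) (hK : ∀ i j, cexp (x i * y j) ∈ K) :
    (2 : Cardinal) ≤ Algebra.trdeg ℚ ↥(adjoin ℚ ((K : Set ℂ) ∪ Set.range x ∪ Set.range y)) := by
  have hd : 1 ≤ d := by
    rcases Nat.eq_zero_or_pos d with rfl | hd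
    · omega
    · exact hd
  have hl : 1 ≤ l := by
    rcases Nat.eq_zero_or_pos l with rfl | hl
    · omega
    · exact hl
  have hmn : d + l + 1 ≤ d * l := by omega
  exact (Laurent2001_thm_3_1_iv_holds d l x y hd hl hx hy hmn).trans
    (trdeg_mono (gridField₂_le_of_mem hK))

/-- **`Diaz1989_gridXY` in the range `dℓ ≤ 2(ℓ+d)`, PROVED** (no Technical Hypothesis is used):
there `⌈dℓ/(ℓ+d)⌉ = 2` (`DiazGrid.natCeil_eq_two`) and `t₂ ≥ 2` is
`Diaz1989_gridXY.two_le_trdeg`. This covers `d = 2` (`ℓ ≥ 3`), `ℓ = 2` (`d ≥ 3`) and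
`(d, ℓ) ∈ {(3,3), (3,4), (3,5), (3,6), (4,3), (4,4), (5,3), (6,3)}` (`DiazGrid.smallRange_iff`).
[cite: NesterenkoPhilippon2001, Ch. 14 Theorem 2.7 (t₂), range dℓ ≤ 2(ℓ+d), via Theorem 2.9] -/
theorem Diaz1989_gridXY_smallRange (d l : ℕ) (x : Fin d → ℂ) (y : Fin l → ℂ)
    (hx : LinearIndependent ℚ x) (hy : LinearIndependent ℚ y) (h : l + d < d * l)
    (h2 : d * l ≤ 2 * (l + d)) (K : IntermediateField ℚ ℂ) (hK : ∀ i j, cexp (x i * y j) ∈ K) :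
    ((⌈(d * l : ℚ) / (l + d)⌉₊ : ℕ) : Cardinal) ≤
      Algebra.trdeg ℚ ↥(adjoin ℚ ((K : Set ℂ) ∪ Set.range x ∪ Set.range y)) := by
  rw [DiazGrid.natCeil_eq_two h h2, Nat.cast_ofNat]
  exact Diaz1989_gridXY.two_le_trdeg x y hx hy h K hK

/-! ### Reductions of the fact -/

/-- **Reduction to the generated field**: to prove `Diaz1989_gridXY` it suffices to bound the
transcendence degree of `gridField₂ x y = ℚ(x, y, e^{xᵢyⱼ})`; the printed "`K` any subfield of `ℂ`
containing the `e^{xᵢyⱼ}`" follows since `gridField₂ x y ≤ K(x, y)` (`gridField₂_le_of_mem`,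
`trdeg_mono`). [cite: NesterenkoPhilippon2001, Ch. 14 Theorem 2.7 (t₂)] -/
theorem Diaz1989_gridXY_of_gridField₂
    (h : ∀ (d l : ℕ) (x : Fin d → ℂ) (y : Fin l → ℂ),
      LinearIndependent ℚ x → TechnicalHypothesis x →
      LinearIndependent ℚ y → TechnicalHypothesis y → l + d < d * l →
        ((⌈(d * l : ℚ) / (l + d)⌉₊ : ℕ) : Cardinal) ≤ Algebra.trdeg ℚ (gridField₂ x y)) :
    Diaz1989_gridXY := by
  intro d l x y hx hTx hy hTy hlt K hK
  exact (h d l x y hx hTx hy hTy hlt).trans (trdeg_mono (gridField₂_le_of_mem hK))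

/-- **Reduction to the range `2(ℓ+d) < dℓ`** (bound `≥ 3`, `DiazGrid.three_le_natCeil`): the
complementary range `dℓ ≤ 2(ℓ+d)` is `Diaz1989_gridXY_smallRange`, so `Diaz1989_gridXY` follows
from its restriction to `2(ℓ+d) < dℓ` on the generated field.
[cite: NesterenkoPhilippon2001, Ch. 14 Theorem 2.7 (t₂)] -/
theorem Diaz1989_gridXY_of_largeRange
    (h : ∀ (d l : ℕ) (x : Fin d → ℂ) (y : Fin l → ℂ),
      LinearIndependent ℚ x → TechnicalHypothesis x →
      LinearIndependent ℚ y → TechnicalHypothesis y → 2 * (l + d) < d * l →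
        ((⌈(d * l : ℚ) / (l + d)⌉₊ : ℕ) : Cardinal) ≤ Algebra.trdeg ℚ (gridField₂ x y)) :
    Diaz1989_gridXY := by
  intro d l x y hx hTx hy hTy hlt K hK
  rcases Nat.lt_or_ge (2 * (l + d)) (d * l) with hbig | hsmall
  · exact (h d l x y hx hTx hy hTy hbig).trans (trdeg_mono (gridField₂_le_of_mem hK))
  · exact Diaz1989_gridXY_smallRange d l x y hx hy hlt hsmall K hK

/-- **What is left is conclusion (i) of Philippon's Théorème 2.12 in the range `2(k+ℓ) < kℓ`**:
if, for all families `x₁, …, x_k`, `y₁, …, y_ℓ` satisfying the Technical Hypothesis with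
`2(k+ℓ) < kℓ`, `trdeg_ℚ ℚ(xᵢ, yⱼ, e^{xᵢyⱼ}) ≥ kℓ/(k+ℓ)` (encoded `⌈kℓ/(k+ℓ)⌉ ≤ trdeg`, the shape of
`Philippon1986_thm_2_12` (i)), then `Diaz1989_gridXY` holds. (The full Théorème 2.12 gives the fact
directly: `Diaz1989_gridXY_of_philippon`.)
[cite: Philippon1986Criteres, Théorème 2.12 (i), p. 40]
[cite: NesterenkoPhilippon2001, Ch. 14 §2.3, p. 217] -/
theorem Diaz1989_gridXY_of_philippon_i_largeRange
    (h : ∀ (k l : ℕ) (x : Fin k → ℂ) (y : Fin l → ℂ),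
      TechnicalHypothesis x → TechnicalHypothesis y → 2 * (k + l) < k * l →
        ((⌈(k * l : ℚ) / (k + l)⌉₊ : ℕ) : Cardinal) ≤
          Algebra.trdeg ℚ ↥(adjoin ℚ (Set.range x ∪ Set.range y ∪
            Set.range fun p : Fin k × Fin l => cexp (x p.1 * y p.2)))) :
    Diaz1989_gridXY := by
  refine Diaz1989_gridXY_of_largeRange fun d l x y _hx hTx _hy hTy hlt => ?_
  have hlt' : 2 * (d + l) < d * l := by omega
  have e : ((l : ℚ) + d) = d + l := add_comm _ _
  rw [e]
  exact h d l x y hTx hTy hlt'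

end Literature.NumberTheory.Transcendental

end
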